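import Mathlib
import HarnessLib

/-!
# Crux `NoZenoR` / `NoZeno` (stmt-ResolutionOfSingularities-19943 / -16483), β2 descent, `stub_L1wCore` (F1) route,
# BC-2 algebra (ii): a finite separable extension SPLITS over any base field into finitely many fields whose degrees add up

OURS (cell res-hironaka, chain W4.4; stub worker res-L0-w44-stub-2 g11; brick DAG `L1W-PREP-v2.md` ba8640c568c3f54d
§2.1 D3 / BC-2b (ii)).  Pure commutative algebra over Mathlib; nothing here is a statement of the manuscript under review;
AI-written, weaker than expert review.

For `L/κ` finite separable (the separable constant field `L_η = κ^sep ∩ κ(η)` of an integral exceptional curve) and any field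
extension `K'/κ` (the residue field `κ_B` of the splitting base, or `κ(y)` of the next germ):

* `isReduced_tensorProduct_of_isSeparable` — `K' ⊗_κ L` is reduced (Mathlib: separable ⇒ formally unramified ⇒ base change
  ⇒ reduced over a field);
* `finite_maximalSpectrum_tensorProduct` — it is Artinian, so it has finitely many maximal ideals (the points `ζ_j` of the
  fibre over `η`);
* `finsum_finrank_quotient_maximalSpectrum_eq` — **`Σ_𝔪 [ (K' ⊗_κ L)/𝔪 : K' ] = [L : κ]`**: the split weights of the curves over
  `η` after base change add up to the split weight of `η` (`IsArtinianRing.equivPi` + `Module.finrank_baseChange`).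
-/

noncomputable section

-- single-problem summit: the doubled namespace component `ResolutionOfSingularities` is forced
set_option linter.dupNamespace false

namespace Summit.ResolutionOfSingularities.ResolutionOfSingularities.Theorems.NoZeno.ExcCount

open TensorProduct

variable (κ L K' : Type*) [Field κ] [Field L] [Field K'] [Algebra κ L] [Algebra κ K']

/-- `K' ⊗_κ L` is reduced when `L/κ` is separable algebraic. [this work] -/
theorem isReduced_tensorProduct_of_isSeparable [Algebra.IsSeparable κ L] [FiniteDimensional κ L] :
    IsReduced (K' ⊗[κ] L) := by
  haveI : Algebra.FormallyUnramified κ L := Algebra.FormallyUnramified.of_isSeparable κ L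
  haveI : Algebra.FormallyUnramified K' (K' ⊗[κ] L) := inferInstance
  haveI : Module.Finite K' (K' ⊗[κ] L) := inferInstance
  haveI : Algebra.EssFiniteType K' (K' ⊗[κ] L) := inferInstance
  exact Algebra.FormallyUnramified.isReduced_of_field K' (K' ⊗[κ] L)

/-- `K' ⊗_κ L` is a finite-dimensional `K'`-algebra, hence Artinian with finitely many maximal ideals. [this work] -/
theorem isArtinianRing_tensorProduct [FiniteDimensional κ L] : IsArtinianRing (K' ⊗[κ] L) :=
  IsArtinianRing.of_finite K' (K' ⊗[κ] L)

/-- **The degrees of the factor fields add up**: for `L/κ` finite separable and any field `K'/κ`,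
`Σ_𝔪 [ (K' ⊗_κ L)/𝔪 : K' ] = [L : κ]`, the (finite, `finsum`) sum over the maximal ideals of `K' ⊗_κ L`. [this work] -/
theorem finsum_finrank_quotient_maximalSpectrum_eq [Algebra.IsSeparable κ L] [FiniteDimensional κ L] :
    ∑ᶠ 𝔪 : MaximalSpectrum (K' ⊗[κ] L), Module.finrank K' ((K' ⊗[κ] L) ⧸ 𝔪.asIdeal) = Module.finrank κ L := by
  haveI := isArtinianRing_tensorProduct κ L K'
  letI : Fintype (MaximalSpectrum (K' ⊗[κ] L)) := Fintype.ofFinite _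
  haveI := isReduced_tensorProduct_of_isSeparable κ L K'
  haveI hfree : ∀ 𝔪 : MaximalSpectrum (K' ⊗[κ] L), Module.Free K' ((K' ⊗[κ] L) ⧸ 𝔪.asIdeal) :=
    fun _ => Module.Free.of_divisionRing K' _
  haveI hfin : ∀ 𝔪 : MaximalSpectrum (K' ⊗[κ] L), Module.Finite K' ((K' ⊗[κ] L) ⧸ 𝔪.asIdeal) :=
    fun 𝔪 => Module.Finite.of_surjective (Ideal.Quotient.mkₐ K' 𝔪.asIdeal).toLinearMap
      (Ideal.Quotient.mkₐ_surjective K' 𝔪.asIdeal)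
  -- the Chinese-remainder decomposition, `K'`-linearly
  let e : (K' ⊗[κ] L) ≃ₐ[K' ⊗[κ] L] ∀ 𝔪 : MaximalSpectrum (K' ⊗[κ] L), (K' ⊗[κ] L) ⧸ 𝔪.asIdeal :=
    IsArtinianRing.equivPi (K' ⊗[κ] L)
  let e' : (K' ⊗[κ] L) ≃ₗ[K'] ∀ 𝔪 : MaximalSpectrum (K' ⊗[κ] L), (K' ⊗[κ] L) ⧸ 𝔪.asIdeal :=
    (e.restrictScalars K').toLinearEquiv
  rw [finsum_eq_sum_of_fintype, ← Module.finrank_pi_fintype K', ← e'.finrank_eq, Module.finrank_baseChange]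

end Summit.ResolutionOfSingularities.ResolutionOfSingularities.Theorems.NoZeno.ExcCount

end
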